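import Summits.Ventures.HodgeRepro2.T5BergmanCoefficientL2
import Summits.Ventures.HodgeRepro2.T5U11CoefficientL2

/-!
# The Bergman model on `H_j = U(1,1)` and the `L²`-integral of its coefficient

The weight-`k` formula `(π_k(g) f)(z) = j(g⁻¹, z)^{-k} f(g⁻¹ · z)` makes sense for every
`g ∈ U(1,1) ⊂ GL₂(ℂ)` (scalars act trivially on the disc, `j(λ⁻¹ h⁻¹, z) = λ⁻¹ j(h⁻¹, z)`), and
defines the extension of `π_k` from `SU(1,1)` to `U(1,1) = Z · SU(1,1)` with central character
`λ ↦ λ^k` on the scalar circle `Z = {λ · 1}`: `actU k (scalarHom λ) f = λ^k f`,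
`actU k (incl h) = act k h`.  Its lowest-weight coefficient `coeffU g = ⟨π₃(g) 1, 1⟩` satisfies
`coeffU (λ h) = λ³ coeff h`, so `|coeffU|² = (π/2)² · coeffSqU` and, by `T5U11CoefficientL2`,

  `c_U • ∫_{U(1,1)} |⟨π₃(g) 1, 1⟩|² dμ_U = (π/2)² · π/2`   for every Haar measure `μ_U` of `U(1,1)`

— S4 l. 83's `∫_{H_j} |⟨π f, f⟩|² = ‖f‖⁴ · vol(Z_j) κ_j / 2` for the explicit model over `H_j`, the
positive constant `c_U⁻¹` standing for the printed `vol(Z_j) κ_j` (the normalisation of `μ_U`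
against the product measure `haarCircle ⊗ ν`).

Blind lane: Mathlib + the HodgeRepro2 prefix only; no sorry; axioms ⊆ {propext, Classical.choice,
Quot.sound}.
-/

namespace Summit.Ventures.HodgeRepro2.T5BergmanU11

open MeasureTheory MeasureTheory.Measure Metric
open T5PoincareDensity T5SU11Unimodular T5U11Unimodular T5U11Product T5SU11Fibration
  T5SU11FibrationHaar T5HaarCircle T5SU11CoefficientL2 T5SU11CoefficientPow T5U11CoefficientL2
  T5BergmanCoefficient T5BergmanUnitary T5BergmanCoefficientL2
open Matrix hiding J
open scoped Real

/-! ### The action of `U(1,1)` -/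

/-- The matrix of `g ∈ U(1,1)`. -/
abbrev matU (g : U11) : Matrix (Fin 2) (Fin 2) ℂ := ((g : GL (Fin 2) ℂ) : Matrix (Fin 2) (Fin 2) ℂ)

/-- The weight-`k` action of `U(1,1)`: `(π_k(g) f)(z) = j(g⁻¹, z)^{-k} f(g⁻¹ · z)`, the same formula
as `act` on `SU(1,1)`. -/
noncomputable def actU (k : ℕ) (g : U11) (f : ℂ → ℂ) (z : ℂ) : ℂ :=
  (denom (matU g⁻¹) z)⁻¹ ^ k * f (mobius (matU g⁻¹) z)

/-- `matU (incl h) = mat h`. -/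
lemma matU_incl (h : SU11) : matU (incl h) = mat h := coe_incl h

/-- **Restriction to `SU(1,1)`**: `actU k (incl h) = act k h`. -/
theorem actU_incl (k : ℕ) (h : SU11) (f : ℂ → ℂ) (z : ℂ) :
    actU k (incl h) f z = act k h f z := by
  unfold actU act
  rw [← map_inv, matU_incl]

/-- The matrix of `(scalarHom λ)⁻¹` is `λ⁻¹ • 1`. -/
lemma matU_scalarHom_inv (lam : Circle) : matU (scalarHom lam)⁻¹ = ((lam⁻¹ : Circle) : ℂ) • 1 := by
  rw [← map_inv]
  exact coe_scalarHom lam⁻¹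

/-- **The central character**: `actU k (scalarHom λ) f = λ^k · f` (`λ ∈ Z ≅ U(1)`). -/
theorem actU_scalarHom (k : ℕ) (lam : Circle) (f : ℂ → ℂ) (z : ℂ) :
    actU k (scalarHom lam) f z = (lam : ℂ) ^ k * f z := by
  unfold actU
  rw [matU_scalarHom_inv, Circle.coe_inv]
  have hl : (lam : ℂ) ≠ 0 := Circle.coe_ne_zero lam
  simp only [denom, mobius, Matrix.smul_apply, Matrix.one_apply_ne (show (1 : Fin 2) ≠ 0 by decide),
    Matrix.one_apply_ne (show (0 : Fin 2) ≠ 1 by decide), Matrix.one_apply_eq, smul_eq_mul, mul_zero,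
    zero_mul, zero_add, mul_one, add_zero, inv_inv, mul_div_cancel_left₀ _ (inv_ne_zero hl)]

/-- **The action on `Z · SU(1,1)`**: `actU k (mulHom (λ, h)) f z = λ^k · act k h f z`
(`mulHom (λ, h) = scalarHom λ · incl h`). -/
theorem actU_mulHom (k : ℕ) (lam : Circle) (h : SU11) (f : ℂ → ℂ) (z : ℂ) :
    actU k (mulHom (lam, h)) f z = (lam : ℂ) ^ k * act k h f z := by
  rw [mulHom_apply]
  unfold actU
  have hmat : matU (scalarHom lam * incl h)⁻¹ = ((lam⁻¹ : Circle) : ℂ) • mat h⁻¹ := by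
    rw [_root_.mul_inv_rev, ← map_inv, ← map_inv]
    show ((((incl h⁻¹ * scalarHom lam⁻¹ : U11) : GL (Fin 2) ℂ)) : Matrix (Fin 2) (Fin 2) ℂ) = _
    rw [Subgroup.coe_mul, Units.val_mul, coe_scalarHom, coe_incl, Matrix.mul_smul, Matrix.mul_one]
  have hl : (lam : ℂ) ≠ 0 := Circle.coe_ne_zero lam
  rw [hmat, Circle.coe_inv, mobius_smul _ (inv_ne_zero hl)]
  unfold act
  simp only [denom, Matrix.smul_apply, smul_eq_mul]
  rw [show (lam : ℂ)⁻¹ * mat h⁻¹ 1 0 * z + (lam : ℂ)⁻¹ * mat h⁻¹ 1 1 =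
    (lam : ℂ)⁻¹ * (mat h⁻¹ 1 0 * z + mat h⁻¹ 1 1) by ring, mul_inv, inv_inv, mul_pow]
  ring

/-! ### The lowest-weight coefficient on `U(1,1)` -/

/-- The lowest-weight coefficient of the weight-`3` model on `U(1,1)`: `g ↦ ⟨π₃(g) 1, 1⟩₃`. -/
noncomputable def coeffU (g : U11) : ℂ := pairing 3 (actU 3 g lowest) lowest

/-- `coeffU (λ h) = λ³ · coeff h`. -/
theorem coeffU_mulHom (lam : Circle) (h : SU11) :
    coeffU (mulHom (lam, h)) = (lam : ℂ) ^ 3 * coeff h := by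
  unfold coeffU coeff
  rw [← pairing_smul_left]
  apply pairing_congr _ (fun _ _ => rfl)
  intro z _
  exact actU_mulHom 3 lam h lowest z

/-- `|coeffU (λ h)| = |coeff h|`: the central character is unitary. -/
theorem norm_coeffU_mulHom (lam : Circle) (h : SU11) :
    ‖coeffU (mulHom (lam, h))‖ = ‖coeff h‖ := by
  rw [coeffU_mulHom, norm_mul, norm_pow, Circle.norm_coe, one_pow, one_mul]

/-- **`|coeffU g|² = (π/2)² · coeffSqU g`** on all of `U(1,1)` — the coefficient squared IS (up to
`‖1‖⁴`) the function integrated over `H_j` in `T5U11CoefficientL2`. -/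
theorem norm_coeffU_sq (g : U11) : ‖coeffU g‖ ^ 2 = (π / 2) ^ 2 * coeffSqU g := by
  obtain ⟨⟨lam, h⟩, rfl⟩ := mulHom_surjective g
  rw [norm_coeffU_mulHom, norm_coeff_sq, coeffSqU_eq_coeffPowU, coeffPowU_mulHom,
    coeffPow_two_eq_coeffSq]

/-- `coeffU` is invariant under the centre up to the character: `|coeffU (λ g)| = |coeffU g|`. -/
theorem norm_coeffU_scalarHom_mul (lam : Circle) (g : U11) :
    ‖coeffU (scalarHom lam * g)‖ = ‖coeffU g‖ := by
  have h1 := norm_coeffU_sq (scalarHom lam * g)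
  have h2 := norm_coeffU_sq g
  rw [show coeffSqU (scalarHom lam * g) = coeffSqU g by
    rw [coeffSqU_eq_coeffPowU, coeffPowU_scalarHom_mul]] at h1
  exact (sq_eq_sq₀ (norm_nonneg _) (norm_nonneg _)).mp (h1.trans h2.symm)

/-! ### The `L²`-integral over `H_j = U(1,1)` -/

variable [MeasurableSpace Circle] [BorelSpace Circle] [MeasurableSpace U11] [BorelSpace U11]

/-- `|coeffU|²` is integrable against every Haar measure of `U(1,1)`. -/
theorem integrable_norm_coeffU_sq (μU : Measure U11) [IsHaarMeasure μU] :
    Integrable (fun g => ‖coeffU g‖ ^ 2) μU := by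
  rw [show (fun g => ‖coeffU g‖ ^ 2) = fun g => (π / 2) ^ 2 * coeffSqU g from funext norm_coeffU_sq,
    coeffSqU_eq_coeffPowU]
  exact (integrable_coeffPowU μU 2 (by norm_num)).const_mul _

/-- **S4 l. 83 over `H_j = U(1,1)` for the explicit model**:
`c_U • ∫_{U(1,1)} |⟨π₃(g) 1, 1⟩|² dμ_U = (π/2)² · π/2` for every Haar measure `μ_U` of `U(1,1)`,
`c_U = haarScalarFactor (map mulHom (haarCircle ⊗ ν)) μ_U > 0`. -/
theorem integral_norm_coeffU_sq (μU : Measure U11) [IsHaarMeasure μU] :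
    (haarScalarFactor (map mulHom (haarCircle.prod (nu haarCircle))) μU : ℝ) •
      ∫ g, ‖coeffU g‖ ^ 2 ∂μU = (π / 2) ^ 2 * (π / 2) := by
  have h := integral_coeffSqU μU
  rw [smul_eq_mul] at h
  rw [show (fun g => ‖coeffU g‖ ^ 2) = fun g => (π / 2) ^ 2 * coeffSqU g from funext norm_coeffU_sq,
    integral_const_mul, smul_eq_mul, mul_left_comm, h]

/-- The integral itself is positive: `∫_{U(1,1)} |⟨π₃(g) 1, 1⟩|² dμ_U > 0` (P3's `Z > 0`). -/
theorem integral_norm_coeffU_sq_pos (μU : Measure U11) [IsHaarMeasure μU] :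
    0 < ∫ g, ‖coeffU g‖ ^ 2 ∂μU := by
  have h := integral_norm_coeffU_sq μU
  rw [smul_eq_mul] at h
  have hc : (0 : ℝ) < haarScalarFactor (map mulHom (haarCircle.prod (nu haarCircle))) μU := by
    exact_mod_cast haarScalarFactor_pos haarCircle (nu haarCircle) μU
  have hπ : (0 : ℝ) < (π / 2) ^ 2 * (π / 2) := by positivity
  refine lt_of_not_ge fun hle => ?_
  nlinarith

end Summit.Ventures.HodgeRepro2.T5BergmanU11
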